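import Mathlib
import HarnessLib

/-!
# Line `taylor-model` on crux K1b-DR (`ExactWindowRungThree.DerivativeEnclosureCertificateR`,
# stmt-NavierStokesRegularity-23954) — VECTOR STEP LEMMA, part 1: the bilinear field on a box and the
# rough-enclosure existence / confinement theorem

Helper toward the COMPONENTWISE (vector) majorant pivot of the certificate format (director dss_56 (i),
scoping memo `pub/pub-ns-dss/certificates/S1-VECTOR-23954.md` §1, §4 (C)).  Abstract setting, NO weights
and NO scalar bilinear bound: a finite index type `ι`, a bilinear field `Q` on `ι → ℝ` (bundled as
`(ι → ℝ) →ₗ[ℝ] (ι → ℝ) →ₗ[ℝ] ι → ℝ`; an unbundled field with `IsLinearMap` in each slot is bundled by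
`LinearMap.mk₂`, definitionally `Q u v`), the autonomous quadratic system `ψ' = Q(ψ,ψ)`, solutions on
`[0,h]` in the literal clause shape of S1 (`ψ 0 = x₀`, `HasDerivWithinAt ψ (Q (ψ s) (ψ s)) (Icc 0 h) s`).

* `Q_expand`, `exists_norm_Q_le`: coordinate form and a sup-norm bound `‖Q u v‖ ≤ C ‖u‖ ‖v‖`;
* `sol_unique`: two solutions on `[0,t]` from one point coincide (Grönwall);
* `norm_le_of_mem_Icc`, `clamp_*`: the box `Set.Icc lo hi ⊆ ι → ℝ` and its coordinatewise clamp;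
* `exists_sol_mem_Icc_of_roughEnclosure` — the FIRST-ORDER ROUGH-ENCLOSURE TEST (Moore / Lohner):
  if `x₀ ∈ [lo,hi]` and `x₀ + u • Q y y ∈ [lo,hi]` for every `y ∈ [lo,hi]`, `u ∈ [0,h]` (NON-STRICT), then
  a solution from `x₀` exists on `[0,h]` and stays in `[lo,hi]`.  Proof: Picard–Lindelöf (Mathlib
  `IsPicardLindelof`) for the globally Lipschitz CLAMPED field `y ↦ Q (π y) (π y)`, then a-posteriori
  confinement from the secant form of the test by the mean-value inequality applied to `u ↦ t·α u c`; the
  confined curve never feels the clamp, so it solves the original equation.  No exit-time argument.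

MODEL-lattice bookkeeping only (rung TL-M3 of the NS ladder: one finite-dimensional model ODE); nothing
here is a statement about the Navier–Stokes equations.
-/

noncomputable section

-- the sub-problem namespace repeats the summit name by design (D-0017)
set_option linter.dupNamespace false

namespace Summit.NavierStokesRegularity.NavierStokesRegularity.Theorems.TaylorModelVector

open scoped BigOperators Topology NNReal
open Set Filter Metric

variable {ι : Type*} [Fintype ι] [DecidableEq ι]
  (Q : (ι → ℝ) →ₗ[ℝ] (ι → ℝ) →ₗ[ℝ] ι → ℝ)

/-! ### Coordinate expansion and sup-norm bounds of a bilinear field -/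

/-- Expansion of `Q` in the first argument along the coordinate basis. [folklore] -/
theorem Q_expand_left (u v : ι → ℝ) : Q u v = ∑ a, u a • Q (Pi.single a 1) v := by
  have hu : ∑ a, u a • (Pi.single a (1 : ℝ) : ι → ℝ) = u := by
    conv_rhs => rw [← Finset.univ_sum_single u]
    exact Finset.sum_congr rfl fun a _ => by rw [← Pi.single_smul', smul_eq_mul, mul_one]
  conv_lhs => rw [← hu]
  rw [map_sum, LinearMap.sum_apply]
  exact Finset.sum_congr rfl fun a _ => by rw [map_smul, LinearMap.smul_apply]

/-- Expansion of `Q` in the second argument along the coordinate basis. [folklore] -/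
theorem Q_expand_right (u v : ι → ℝ) : Q u v = ∑ a, v a • Q u (Pi.single a 1) := by
  have hv : ∑ a, v a • (Pi.single a (1 : ℝ) : ι → ℝ) = v := by
    conv_rhs => rw [← Finset.univ_sum_single v]
    exact Finset.sum_congr rfl fun a _ => by rw [← Pi.single_smul', smul_eq_mul, mul_one]
  conv_lhs => rw [← hv]
  rw [map_sum]
  exact Finset.sum_congr rfl fun a _ => by rw [map_smul]

/-- **Coordinate form of the bilinear field**: `Q u v c = Σ_a Σ_a' u_a v_a' · Q(e_a, e_a')_c`.
[folklore] -/
theorem Q_expand (u v : ι → ℝ) (c : ι) :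
    Q u v c = ∑ a, ∑ a', u a * v a' * Q (Pi.single a 1) (Pi.single a' 1) c := by
  rw [Q_expand_left Q u v, Finset.sum_apply]
  refine Finset.sum_congr rfl fun a _ => ?_
  rw [Pi.smul_apply, smul_eq_mul, Q_expand_right Q (Pi.single a 1) v, Finset.sum_apply,
    Finset.mul_sum]
  refine Finset.sum_congr rfl fun a' _ => ?_
  rw [Pi.smul_apply, smul_eq_mul]
  ring

/-- **Sup-norm bound of the field**: `‖Q u v‖ ≤ C ‖u‖ ‖v‖` with `C` the absolute coefficient mass.
[folklore] -/
theorem exists_norm_Q_le : ∃ C : ℝ, 0 ≤ C ∧ ∀ u v : ι → ℝ, ‖Q u v‖ ≤ C * ‖u‖ * ‖v‖ := by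
  set C : ℝ := ∑ c, ∑ a, ∑ a', |Q (Pi.single a 1) (Pi.single a' 1) c| with hC
  have hC0 : 0 ≤ C := by positivity
  refine ⟨C, hC0, fun u v => ?_⟩
  refine (pi_norm_le_iff_of_nonneg (by positivity)).2 fun c => ?_
  rw [Real.norm_eq_abs, Q_expand Q u v c]
  have h1 : |∑ a, ∑ a', u a * v a' * Q (Pi.single a 1) (Pi.single a' 1) c|
      ≤ ∑ a, ∑ a', |Q (Pi.single a 1) (Pi.single a' 1) c| * ‖u‖ * ‖v‖ := by
    refine (Finset.abs_sum_le_sum_abs _ _).trans (Finset.sum_le_sum fun a _ => ?_)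
    refine (Finset.abs_sum_le_sum_abs _ _).trans (Finset.sum_le_sum fun a' _ => ?_)
    rw [abs_mul, abs_mul]
    have hua : |u a| ≤ ‖u‖ := by rw [← Real.norm_eq_abs]; exact norm_le_pi_norm u a
    have hva : |v a'| ≤ ‖v‖ := by rw [← Real.norm_eq_abs]; exact norm_le_pi_norm v a'
    calc |u a| * |v a'| * |Q (Pi.single a 1) (Pi.single a' 1) c|
        ≤ ‖u‖ * ‖v‖ * |Q (Pi.single a 1) (Pi.single a' 1) c| := by gcongr
      _ = _ := by ring
  have h2 : ∑ a, ∑ a', |Q (Pi.single a 1) (Pi.single a' 1) c| ≤ C :=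
    Finset.single_le_sum (f := fun c' => ∑ a, ∑ a', |Q (Pi.single a 1) (Pi.single a' 1) c'|)
      (fun c' _ => by positivity) (Finset.mem_univ c)
  calc |∑ a, ∑ a', u a * v a' * Q (Pi.single a 1) (Pi.single a' 1) c|
      ≤ ∑ a, ∑ a', |Q (Pi.single a 1) (Pi.single a' 1) c| * ‖u‖ * ‖v‖ := h1
    _ = (∑ a, ∑ a', |Q (Pi.single a 1) (Pi.single a' 1) c|) * ‖u‖ * ‖v‖ := by
        rw [Finset.sum_mul, Finset.sum_mul]
        refine Finset.sum_congr rfl fun a _ => ?_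
        rw [Finset.sum_mul, Finset.sum_mul]
    _ ≤ C * ‖u‖ * ‖v‖ := by gcongr

omit [DecidableEq ι] in
/-- **The quadratic field is Lipschitz on every ball** (`u ↦ Q u u` on `closedBall 0 R`, constant
`2 C R`). [folklore] -/
theorem lipschitzOnWith_quad {C : ℝ} (hC0 : 0 ≤ C) (hC : ∀ u v : ι → ℝ, ‖Q u v‖ ≤ C * ‖u‖ * ‖v‖)
    {R : ℝ} (hR : 0 ≤ R) :
    LipschitzOnWith (Real.toNNReal (2 * C * R)) (fun u => Q u u) (closedBall 0 R) := by
  refine LipschitzOnWith.of_dist_le_mul fun u hu v hv => ?_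
  rw [Real.coe_toNNReal _ (by positivity), dist_eq_norm, dist_eq_norm]
  have hu' : ‖u‖ ≤ R := mem_closedBall_zero_iff.1 hu
  have hv' : ‖v‖ ≤ R := mem_closedBall_zero_iff.1 hv
  have e : Q u u - Q v v = Q (u - v) u + Q v (u - v) := by
    rw [map_sub, LinearMap.sub_apply, map_sub]
    abel
  rw [e]
  calc ‖Q (u - v) u + Q v (u - v)‖ ≤ ‖Q (u - v) u‖ + ‖Q v (u - v)‖ := norm_add_le _ _
    _ ≤ C * ‖u - v‖ * ‖u‖ + C * ‖v‖ * ‖u - v‖ := add_le_add (hC _ _) (hC _ _)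
    _ ≤ C * ‖u - v‖ * R + C * R * ‖u - v‖ := by gcongr
    _ = 2 * C * R * ‖u - v‖ := by ring

/-- **Uniqueness**: two solutions of `u' = Q(u,u)` on `[0,t]` from the same point coincide on `[0,t]`
(Grönwall, Mathlib `ODE_solution_unique_of_mem_Icc_right`, with the Lipschitz constant of a ball
containing both compact trajectories). [folklore] -/
theorem sol_unique {x : ι → ℝ} {t : ℝ} {ψ χ : ℝ → ι → ℝ} (hψ0 : ψ 0 = x)
    (hψ : ∀ s ∈ Icc 0 t, HasDerivWithinAt ψ (Q (ψ s) (ψ s)) (Icc 0 t) s) (hχ0 : χ 0 = x)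
    (hχ : ∀ s ∈ Icc 0 t, HasDerivWithinAt χ (Q (χ s) (χ s)) (Icc 0 t) s) : EqOn ψ χ (Icc 0 t) := by
  obtain ⟨C, hC0, hC⟩ := exists_norm_Q_le Q
  have hψc : ContinuousOn ψ (Icc 0 t) := fun s hs => (hψ s hs).continuousWithinAt
  have hχc : ContinuousOn χ (Icc 0 t) := fun s hs => (hχ s hs).continuousWithinAt
  obtain ⟨Cψ, hCψ⟩ := isCompact_Icc.exists_bound_of_continuousOn hψc
  obtain ⟨Cχ, hCχ⟩ := isCompact_Icc.exists_bound_of_continuousOn hχc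
  set R := max (max Cψ Cχ) 0 with hRdef
  have hR : 0 ≤ R := le_max_right _ _
  have hK := lipschitzOnWith_quad Q hC0 hC hR
  have hnhds : ∀ s ∈ Ico (0 : ℝ) t, Icc 0 t ∈ 𝓝[≥] s := fun s hs =>
    mem_of_superset (Icc_mem_nhdsGE hs.2) (Icc_subset_Icc_left hs.1)
  exact ODE_solution_unique_of_mem_Icc_right (v := fun _ u => Q u u)
    (s := fun _ => closedBall 0 R) (fun _ _ => hK) hψc
    (fun s hs => (hψ s (Ico_subset_Icc_self hs)).mono_of_mem_nhdsWithin (hnhds s hs))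
    (fun s hs => mem_closedBall_zero_iff.2
      ((hCψ s (Ico_subset_Icc_self hs)).trans ((le_max_left _ _).trans (le_max_left _ _))))
    hχc
    (fun s hs => (hχ s (Ico_subset_Icc_self hs)).mono_of_mem_nhdsWithin (hnhds s hs))
    (fun s hs => mem_closedBall_zero_iff.2
      ((hCχ s (Ico_subset_Icc_self hs)).trans ((le_max_right _ _).trans (le_max_left _ _))))
    (hψ0.trans hχ0.symm)

/-! ### Boxes `Set.Icc lo hi` in `ι → ℝ` and the coordinatewise clamp -/

omit [DecidableEq ι] in
/-- A box is norm-bounded by `max ‖lo‖ ‖hi‖`. [folklore] -/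
theorem norm_le_of_mem_Icc {lo hi y : ι → ℝ} (hy : y ∈ Icc lo hi) : ‖y‖ ≤ max ‖lo‖ ‖hi‖ := by
  refine (pi_norm_le_iff_of_nonneg (by positivity)).2 fun c => ?_
  rw [Real.norm_eq_abs]
  calc |y c| ≤ max |lo c| |hi c| := abs_le_max_abs_abs (hy.1 c) (hy.2 c)
    _ ≤ max ‖lo‖ ‖hi‖ := max_le_max (by rw [← Real.norm_eq_abs]; exact norm_le_pi_norm lo c)
        (by rw [← Real.norm_eq_abs]; exact norm_le_pi_norm hi c)

omit [Fintype ι] [DecidableEq ι] in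
/-- The clamp `y ↦ (c ↦ max (lo c) (min (y c) (hi c)))` lands in the box (`lo ≤ hi`). [folklore] -/
theorem clamp_mem {lo hi : ι → ℝ} (hlh : lo ≤ hi) (y : ι → ℝ) :
    (fun c => max (lo c) (min (y c) (hi c))) ∈ Icc lo hi :=
  ⟨fun _ => le_max_left _ _, fun c => max_le (hlh c) (min_le_right _ _)⟩

omit [Fintype ι] [DecidableEq ι] in
/-- The clamp fixes the box. [folklore] -/
theorem clamp_eq_self {lo hi y : ι → ℝ} (hy : y ∈ Icc lo hi) :
    (fun c => max (lo c) (min (y c) (hi c))) = y :=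
  funext fun c => by rw [min_eq_left (hy.2 c), max_eq_right (hy.1 c)]

omit [DecidableEq ι] in
/-- The clamp is `1`-Lipschitz for the sup distance. [folklore] -/
theorem dist_clamp_le (lo hi y z : ι → ℝ) :
    dist (fun c => max (lo c) (min (y c) (hi c))) (fun c => max (lo c) (min (z c) (hi c))) ≤ dist y z := by
  refine (dist_pi_le_iff dist_nonneg).2 fun c => ?_
  rw [Real.dist_eq]
  calc |max (lo c) (min (y c) (hi c)) - max (lo c) (min (z c) (hi c))|
      ≤ |min (y c) (hi c) - min (z c) (hi c)| := by
        rw [max_comm (lo c), max_comm (lo c)]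
        exact abs_max_sub_max_le_abs _ _ _
    _ ≤ max |y c - z c| |hi c - hi c| := abs_min_sub_min_le_max _ _ _ _
    _ = |y c - z c| := by rw [sub_self, abs_zero, max_eq_left (abs_nonneg _)]
    _ = dist (y c) (z c) := (Real.dist_eq _ _).symm
    _ ≤ dist y z := dist_le_pi_dist y z c

/-! ### The rough-enclosure theorem -/

/-- **A-PRIORI (ROUGH) ENCLOSURE ⇒ EXISTENCE + CONFINEMENT** (first-order test, Moore / Lohner): if
`x₀ ∈ [lo,hi]` and `x₀ + u • Q y y ∈ [lo,hi]` for all `y ∈ [lo,hi]`, `u ∈ [0,h]` (checkable as the interval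
inequality `[lo,hi] ⊇ x₀ + [0,h]·Q(B,B)`, NON-STRICT), then the solution of `ψ' = Q(ψ,ψ)`, `ψ 0 = x₀` exists on
`[0,h]` and stays in `[lo,hi]` (the a-priori enclosure step of Lohner's AWA, 1987, §2; Nedialkov–Jackson–
Corliss 1999, Thm 3.1; here for NON-STRICT data via the clamped field). [folklore] -/
theorem exists_sol_mem_Icc_of_roughEnclosure {lo hi x₀ : ι → ℝ} {h : ℝ} (hx₀ : x₀ ∈ Icc lo hi)
    (hh : 0 ≤ h) (henc : ∀ y ∈ Icc lo hi, ∀ u ∈ Icc (0:ℝ) h, x₀ + u • Q y y ∈ Icc lo hi) :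
    ∃ ψ : ℝ → ι → ℝ, ψ 0 = x₀ ∧ (∀ s ∈ Icc 0 h, HasDerivWithinAt ψ (Q (ψ s) (ψ s)) (Icc 0 h) s) ∧
      ∀ s ∈ Icc 0 h, ψ s ∈ Icc lo hi := by
  have hlh : lo ≤ hi := hx₀.1.trans hx₀.2
  -- the clamp and the clamped field
  set π : (ι → ℝ) → (ι → ℝ) := fun y c => max (lo c) (min (y c) (hi c)) with hπ
  have hπmem : ∀ y, π y ∈ Icc lo hi := fun y => clamp_mem hlh y
  have hπeq : ∀ y ∈ Icc lo hi, π y = y := fun y hy => clamp_eq_self hy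
  obtain ⟨C, hC0, hC⟩ := exists_norm_Q_le Q
  set R : ℝ := max ‖lo‖ ‖hi‖ with hRdef
  have hR0 : 0 ≤ R := le_max_of_le_left (norm_nonneg _)
  have hπR : ∀ y, ‖π y‖ ≤ R := fun y => norm_le_of_mem_Icc (hπmem y)
  set F : (ι → ℝ) → (ι → ℝ) := fun y => Q (π y) (π y) with hF
  have hFlip : LipschitzWith (Real.toNNReal (2 * C * R)) F := by
    refine LipschitzWith.of_dist_le_mul fun y z => ?_
    rw [Real.coe_toNNReal _ (by positivity), dist_eq_norm]
    have e : F y - F z = Q (π y - π z) (π y) + Q (π z) (π y - π z) := by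
      simp only [hF]
      rw [map_sub, LinearMap.sub_apply, map_sub]
      abel
    have hd : ‖π y - π z‖ ≤ dist y z := by rw [← dist_eq_norm]; exact dist_clamp_le lo hi y z
    rw [e]
    calc ‖Q (π y - π z) (π y) + Q (π z) (π y - π z)‖
        ≤ ‖Q (π y - π z) (π y)‖ + ‖Q (π z) (π y - π z)‖ := norm_add_le _ _
      _ ≤ C * ‖π y - π z‖ * ‖π y‖ + C * ‖π z‖ * ‖π y - π z‖ := add_le_add (hC _ _) (hC _ _)
      _ ≤ C * dist y z * R + C * R * dist y z := by gcongr <;> exact hπR _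
      _ = 2 * C * R * dist y z := by ring
  have hFbd : ∀ y, ‖F y‖ ≤ C * R * R := fun y =>
    calc ‖F y‖ = ‖Q (π y) (π y)‖ := rfl
      _ ≤ C * ‖π y‖ * ‖π y‖ := hC _ _
      _ ≤ C * R * R := by gcongr <;> exact hπR y
  -- Picard–Lindelöf on `[0,h]` for the clamped (globally Lipschitz, bounded) field
  set L : ℝ≥0 := ⟨C * R * R, by positivity⟩ with hL
  set hN : ℝ≥0 := ⟨h, hh⟩ with hhN
  have t₀mem : (0:ℝ) ∈ Icc (0:ℝ) h := ⟨le_rfl, hh⟩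
  have hPL : IsPicardLindelof (fun (_ : ℝ) (y : ι → ℝ) => F y) (⟨0, t₀mem⟩ : Icc (0:ℝ) h) x₀
      (L * hN) 0 L (Real.toNNReal (2 * C * R)) :=
    { lipschitzOnWith := fun _ _ => hFlip.lipschitzOnWith
      continuousOn := fun _ _ => continuousOn_const
      norm_le := fun _ _ y _ => hFbd y
      mul_max_le := by
        simp only [sub_zero, sub_self, max_eq_left hh, NNReal.coe_mul, NNReal.coe_zero, hL, hhN]
        exact le_rfl }
  obtain ⟨α, hα0, hα⟩ := hPL.exists_eq_forall_mem_Icc_hasDerivWithinAt₀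
  -- a-posteriori confinement from the secant form of the test
  have hconf : ∀ t ∈ Icc 0 h, α t ∈ Icc lo hi := by
    intro t ht
    rcases eq_or_lt_of_le ht.1 with h0 | htpos
    · rw [← h0, hα0]; exact hx₀
    have hsub : Icc 0 t ⊆ Icc 0 h := Icc_subset_Icc_right ht.2
    have key : ∀ c, lo c ≤ α t c ∧ α t c ≤ hi c := by
      intro c
      have hcont : ContinuousOn (fun u => t * α u c) (Icc 0 t) := by
        refine ContinuousOn.mul continuousOn_const ?_
        exact fun u hu => ((hasDerivWithinAt_pi.1 ((hα u (hsub hu)).mono hsub)) c).continuousWithinAt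
      have hderiv : ∀ u ∈ Ioo 0 t, HasDerivAt (fun u => t * α u c) (t * F (α u) c) u := by
        intro u hu
        have h2 : HasDerivAt α (F (α u)) u :=
          (hα u (hsub (Ioo_subset_Icc_self hu))).hasDerivAt (Icc_mem_nhds hu.1 (hu.2.trans_le ht.2))
        exact ((hasDerivAt_pi.1 h2) c).const_mul t
      have hdiff : DifferentiableOn ℝ (fun u => t * α u c) (interior (Icc 0 t)) := by
        rw [interior_Icc]
        exact fun u hu => (hderiv u hu).differentiableAt.differentiableWithinAt
      have hbounds : ∀ u ∈ interior (Icc 0 t),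
          lo c - x₀ c ≤ deriv (fun u => t * α u c) u ∧ deriv (fun u => t * α u c) u ≤ hi c - x₀ c := by
        rw [interior_Icc]
        intro u hu
        rw [(hderiv u hu).deriv]
        have hm := henc (π (α u)) (hπmem _) t ht
        have hl := hm.1 c
        have hr := hm.2 c
        simp only [Pi.add_apply, Pi.smul_apply, smul_eq_mul] at hl hr
        exact ⟨by linarith, by linarith⟩
      have up := (convex_Icc 0 t).image_sub_le_mul_sub_of_deriv_le hcont hdiff
        (fun u hu => (hbounds u hu).2) 0 (left_mem_Icc.2 ht.1) t (right_mem_Icc.2 ht.1) ht.1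
      have low := (convex_Icc 0 t).mul_sub_le_image_sub_of_le_deriv hcont hdiff
        (fun u hu => (hbounds u hu).1) 0 (left_mem_Icc.2 ht.1) t (right_mem_Icc.2 ht.1) ht.1
      rw [hα0, sub_zero] at up low
      have up' : t * α t c ≤ t * hi c := by nlinarith
      have low' : t * lo c ≤ t * α t c := by nlinarith
      exact ⟨le_of_mul_le_mul_left low' htpos, le_of_mul_le_mul_left up' htpos⟩
    exact ⟨fun c => (key c).1, fun c => (key c).2⟩
  -- the confined curve solves the unclamped equation
  refine ⟨α, hα0, fun s hs => ?_, hconf⟩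
  have e : F (α s) = Q (α s) (α s) := by
    simp only [hF]
    rw [hπeq _ (hconf s hs)]
  exact e ▸ hα s hs

end Summit.NavierStokesRegularity.NavierStokesRegularity.Theorems.TaylorModelVector

end
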